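import Summits.KontsevichZagierPeriods.KontsevichZagierPeriods.Theorems.RealOnePeriodRelations.Negative.Kit
import Literature.NumberTheory.Transcendental.KZSubcalculusInvariants

/-!
# `RealOnePeriodRelations` (stmt-KontsevichZagierPeriods-10042) — negative side: rule 2 is load-bearing

Refuter-posited deletion variant of the crux `∀ c ∈ H₁, eval c = 0 → c ∈ M₁`
(`M₁ = closure (1a ∪ 1b ∪ 2 ∪ Green)`): drop the change-of-variables move (rule 2) from the
conclusion subgroup. The variant is FALSE. Invariant: the tree's restricted evaluation
`KZ.restrictedEval offUnitWindow` (`[∫_σ f] ↦ ∫_{σ ∩ A} f` at the window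
`A n = {z | no coordinate of z lies in (0,1)}`) kills domain additivity (1a) and integrand additivity
(1b) (`KZ.closure_add_le_ker_restrictedEval`) and ALSO every Green instance — its three domains are
the unit interval, disjoint from the window — but takes the value `1` on
`[∫_{(1,2)} 1] − [∫_{(0,1)} 1] ∈ H₁ ∩ ker eval`. So any proof of the crux must use rule 2: it is the
only generator of `M₁` that moves mass along `ℝ`. [Kontsevich–Zagier 2001, §1.2]
-/

noncomputable section

open scoped BigOperators Topology
open Set MeasureTheory Filter
open Literature.NumberTheory.Transcendental

namespace Summit.KontsevichZagierPeriods.SymplecticScissors.RealOnePeriodRelationsNegative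

/-! ## The window off the unit interval -/

/-- The window family `offUnitWindow n = {z ∈ ℝⁿ | ∀ i, z i ≤ 0 ∨ 1 ≤ z i}` (no coordinate in
`(0,1)`); for `n = 1` it is the complement of `unitDom`. [folklore] -/
def offUnitWindow (n : ℕ) : Set (Fin n → ℝ) := {z | ∀ i, z i ≤ 0 ∨ 1 ≤ z i}

/-- Every window `offUnitWindow n` is measurable. [folklore] -/
theorem measurableSet_offUnitWindow (n : ℕ) : MeasurableSet (offUnitWindow n) := by
  have h : offUnitWindow n = ⋂ i, ({z : Fin n → ℝ | z i ≤ 0} ∪ {z | 1 ≤ z i}) := by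
    ext z
    simp [offUnitWindow]
  rw [h]
  exact MeasurableSet.iInter fun i =>
    (measurableSet_le (measurable_pi_apply i) measurable_const).union
      (measurableSet_le measurable_const (measurable_pi_apply i))

/-- The unit interval misses the window. [folklore] -/
theorem inter_offUnitWindow_eq_empty {r : KZ.IntegralRep 1} (hr : r.domain = {z | z 0 ∈ Set.Ioo 0 1}) :
    r.domain ∩ offUnitWindow 1 = ∅ := by
  rw [hr]
  ext z
  simp only [offUnitWindow, Fin.forall_fin_one, mem_inter_iff, mem_setOf_eq, mem_Ioo,
    mem_empty_iff_false, iff_false, not_and]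
  rintro ⟨h0, h1⟩ (h | h) <;> linarith

/-- The restricted evaluation at `offUnitWindow` kills every Green instance (its three domains are
the unit interval). [cite: KontsevichZagier2001, §1.2] -/
theorem restrictedEval_eq_zero_of_mem_greenSet {g : KZ.FormalRep} (hg : g ∈ greenSet) :
    KZ.restrictedEval offUnitWindow g = 0 := by
  obtain ⟨Δ', A, B, S, r₀₁, r₁₂, r₀₂, -, -, -, -, -, -, hd₁, hd₂, hd₃, -, -, -, rfl⟩ := hg
  simp [map_sub, map_add, KZ.restrictedEval_of, inter_offUnitWindow_eq_empty hd₁,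
    inter_offUnitWindow_eq_empty hd₂, inter_offUnitWindow_eq_empty hd₃]

/-! ## The deletion variant and its refutation -/

/-- `M₁` WITHOUT rule 2: rules 1a, 1b and the Green generator only. [cite: KontsevichZagier2001, §1.2] -/
def M₁noCov : AddSubgroup KZ.FormalRep :=
  AddSubgroup.closure (KZ.domainAddRel ∪ KZ.integrandAddRel ∪ greenSet)

/-- `M₁noCov ≤ M₁`. [folklore] -/
theorem M₁noCov_le_M₁ : M₁noCov ≤ M₁ := by
  refine AddSubgroup.closure_mono ?_
  rintro c ((hc | hc) | hc)
  · exact Or.inl (Or.inl (Or.inl hc))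
  · exact Or.inl (Or.inl (Or.inr hc))
  · exact Or.inr hc

/-- `M₁noCov` lies in the kernel of the restricted evaluation at `offUnitWindow` (1a and 1b by
`KZ.closure_add_le_ker_restrictedEval`, Green by `restrictedEval_eq_zero_of_mem_greenSet`).
[cite: KontsevichZagier2001, §1.2] -/
theorem M₁noCov_le_ker_restrictedEval : M₁noCov ≤ (KZ.restrictedEval offUnitWindow).ker := by
  refine (AddSubgroup.closure_le _).mpr ?_
  rintro c ((hc | hc) | hc)
  · exact KZ.restrictedEval_eq_zero_of_mem_domainAddRel _ measurableSet_offUnitWindow hc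
  · exact KZ.restrictedEval_eq_zero_of_mem_integrandAddRel _ measurableSet_offUnitWindow hc
  · exact restrictedEval_eq_zero_of_mem_greenSet hc

/-- The crux WITHOUT rule 2 in the conclusion (a refuter-posited deletion variant for the
load-bearing test, not a statement from the literature). -/
def RealOnePeriodRelationsWithoutRule2 : Prop :=
  ∀ c : KZ.FormalRep, c ∈ H₁ → KZ.eval c = 0 → c ∈ M₁noCov

/-- The shifted unit interval `{z : ℝ¹ | z 0 ∈ (1,2)}`. [folklore] -/
def shiftDom : Set (Fin 1 → ℝ) := {z | z 0 ∈ Set.Ioo 1 2}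

/-- `shiftDom` is the preimage of `(1,2)` under `ℝ¹ ≃ ℝ`. [folklore] -/
theorem funUnique_preimage_Ioo_one_two :
    (MeasurableEquiv.funUnique (Fin 1) ℝ) ⁻¹' Set.Ioo 1 2 = shiftDom := by
  ext z
  simp [shiftDom, MeasurableEquiv.funUnique_apply, Fin.default_eq_zero]

/-- The volume of `shiftDom` is `1`. [folklore] -/
theorem volume_shiftDom : volume shiftDom = 1 := by
  have hmp : MeasurePreserving (MeasurableEquiv.funUnique (Fin 1) ℝ) volume volume :=
    volume_preserving_funUnique (Fin 1) ℝ
  rw [← funUnique_preimage_Ioo_one_two, hmp.measure_preimage measurableSet_Ioo.nullMeasurableSet]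
  simp only [Real.volume_Ioo]
  norm_num

/-- `shiftDom` is `ℚ`-semialgebraic (`1 < z₀` and `z₀ < 2`). [folklore] -/
theorem isSemialgebraic_shiftDom : Literature.ModelTheory.ExponentialFields.IsSemialgebraic ℚ shiftDom := by
  have h1 := Literature.ModelTheory.ExponentialFields.isSemialgebraic_setOf_eval_pos (k := ℚ)
    (R := ℝ) (MvPolynomial.X (0 : Fin 1) - 1 : MvPolynomial (Fin 1) ℚ)
  have h2 := Literature.ModelTheory.ExponentialFields.isSemialgebraic_setOf_eval_pos (k := ℚ)
    (R := ℝ) (2 - MvPolynomial.X (0 : Fin 1) : MvPolynomial (Fin 1) ℚ)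
  convert h1.inter h2 using 1
  ext z
  simp [shiftDom, sub_pos]

/-- The representation `[∫_{(1,2)} 1]` (dimension 1). [folklore] -/
def shiftRep : KZ.IntegralRep 1 where
  domain := shiftDom
  integrand := fun _ => 1
  isSemialgebraic_domain := isSemialgebraic_shiftDom
  isSemialgebraicFunOn_integrand := by
    simpa using isSemialgebraicFunOn_ratConst isSemialgebraic_shiftDom 1
  integrableOn := integrableOn_const (by simp [volume_shiftDom])

/-- `value [∫_{(1,2)} 1] = 1`. [folklore] -/
theorem value_shiftRep : shiftRep.value = 1 := by
  simp [KZ.IntegralRep.value, shiftRep, Measure.real, volume_shiftDom]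

/-- `shiftDom ⊆ offUnitWindow 1`. [folklore] -/
theorem shiftDom_inter_offUnitWindow : shiftDom ∩ offUnitWindow 1 = shiftDom := by
  ext z
  simp only [offUnitWindow, Fin.forall_fin_one, shiftDom, mem_inter_iff, mem_setOf_eq, mem_Ioo]
  constructor
  · exact fun h => h.1
  · exact fun h => ⟨h, Or.inr h.1.le⟩

/-- `restrictedEval offUnitWindow [∫_{(1,2)} 1] = 1`. [folklore] -/
theorem restrictedEval_shiftRep : KZ.restrictedEval offUnitWindow (KZ.of shiftRep) = 1 := by
  rw [KZ.restrictedEval_of]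
  change ∫ z in shiftDom ∩ offUnitWindow 1, (fun _ => (1:ℝ)) z = 1
  rw [shiftDom_inter_offUnitWindow]
  simp [Measure.real, volume_shiftDom]

/-- `restrictedEval offUnitWindow [∫_{(0,1)} q] = 0`. [folklore] -/
theorem restrictedEval_constRep₁ (q : ℚ) : KZ.restrictedEval offUnitWindow (KZ.of (constRep₁ q)) = 0 := by
  rw [KZ.restrictedEval_of, inter_offUnitWindow_eq_empty (r := constRep₁ q) rfl]
  simp

/-- **Rule 2 is load-bearing**: without the change-of-variables move the crux is FALSE —
`c = [∫_{(1,2)} 1] − [∫_{(0,1)} 1] ∈ H₁` has `eval c = 0`, but `c ∉ closure (1a ∪ 1b ∪ Green)`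
because the restricted evaluation at `offUnitWindow` vanishes there
(`M₁noCov_le_ker_restrictedEval`) while it takes the value `1` on `c`. Any proof of the crux must
use rule 2 (the only generator of `M₁` that moves mass along `ℝ`). [cite: KontsevichZagier2001, §1.2] -/
theorem realOnePeriodRelations_false_without_rule2 : ¬ RealOnePeriodRelationsWithoutRule2 := by
  intro h
  have hmem : KZ.of shiftRep - KZ.of (constRep₁ 1) ∈ H₁ :=
    H₁.sub_mem (AddSubgroup.subset_closure ⟨shiftRep, rfl⟩)
      (AddSubgroup.subset_closure ⟨constRep₁ 1, rfl⟩)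
  have heval : KZ.eval (KZ.of shiftRep - KZ.of (constRep₁ 1)) = 0 := by
    simp [map_sub, KZ.eval_of, value_shiftRep]
  have hker := M₁noCov_le_ker_restrictedEval (h _ hmem heval)
  rw [AddMonoidHom.mem_ker, map_sub, restrictedEval_shiftRep, restrictedEval_constRep₁] at hker
  norm_num at hker

end Summit.KontsevichZagierPeriods.SymplecticScissors.RealOnePeriodRelationsNegative

end
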